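import Summits.AnomalousDissipation.AnomalousDissipation.Theorems.SawtoothPulseCascadeK1LocalisedCascadeSlotCascade
import Summits.AnomalousDissipation.AnomalousDissipation.Theorems.SawtoothPulseCascadeK1LocalisedCascadeSlotFibreSumMax

/-!
# K1loc, line `Spectral` / SeqCone — helper: THE TRACKED-FAMILY STEP ACROSS ONE H HALF-SLOT (S-A assembly, abstract data)

Helper file of the prover lane on the crux `K1LocalisedCascade` (stmt-AnomalousDissipation-19491), route
`SawtoothPulseCascade` (memo v6 §4, S-A "HalfSlotStep").  For ONE strip family (slope sign `σ`) of the H half-slot of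
phase `j` this file composes the two landed halves of the machine into a single inequality in PHYSICAL variables:
 (1) the slot lemma (`…SlotCascade.sqrt_tsum_symbolEnergy_le_H_of_Ico`): the `μ`-energy of the localised pull-back
     `θ = X̃(x₁)·(w(t₁)∘Φ_{−γ})` is at most that of `X̃(x₁)·w(t₀)` plus `E_slot‖w(t₀)‖`;
 (2) the max-compatibility un-gauging step (`…SlotFibreSumMax.sqrt_tsum_symbol_sq_twoStrip_le_of_fibre_max`, one family:
     second cut-off the zero profile): `‖m(D)(X(x₁)·(θ∘Φ_γ))‖ ≤ ‖μ(D)θ‖ + (A + √(2C))‖θ‖` from an abstract per-fibre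
     estimate `hfib` (discharged elsewhere by `…SlotFibreMax` with the symbol compatibilities of `…SymbolCone`);
 (3) kinematics: `Φ_γ` undoes `Φ_{−γ}` and keeps `x₁`, `X·X̃ = X`, so `X(x₁)·(θ∘Φ_γ) = X(x₁)·w(t₁)`; and
     `‖θ‖ ≤ ‖w(t₁)‖ ≤ ‖w(t₀)‖` (|X̃| ≤ 1, measure-preserving shear, `L²` decay).
Result (`sqrt_tsum_symbol_sq_family_step_H`):
  `‖m(D)(X(x₁)w(t₁))‖ ≤ ‖μ(D)(X̃(x₁)w(t₀))‖ + (E_slot + A + √(2C))·‖w(t₀)‖`,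
`E_slot = 2κ·tHalf j·C₂ + 4C₁√(κ·tHalf j/2) + √(γε₁(5 + 6C₁²κ·tHalf j))`, `t₀ = tStart j`, `t₁ = t₀ + tHalf j`.
The two families are recombined by the two-piece lemmas of `…SlotExpansionTwoBranch` / `…SpectralCommutator` (S-C).
No definitions; no statement about the stub.
[cite: BedrossianCotiZelati2017, §2 (energy method in shear coordinates)] [cite: Grafakos2014, Prop. 3.1.2 (5) and
Prop. 3.2.7 (3)] [problem: turb]
-/

-- `Summit.<Summit>.<Problem>`: single-conjunct summit, the duplicate namespace segment is deliberate.
set_option linter.dupNamespace false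

noncomputable section

namespace Summit.AnomalousDissipation.AnomalousDissipation.Theorems.SawtoothPulseCascade.K1Slot

open MeasureTheory Set Filter Topology UnitAddTorus Function
open scoped ContDiff
open Literature.Analysis Literature.Analysis.FunctionSpaces Literature.Analysis.FunctionSpaces.Torus
open Literature.Analysis.FluidPDE.ShearStage
open Literature.Analysis.FluidPDE.SawtoothCascade Literature.Analysis.FluidPDE.SawtoothCascade.CascadeParams

/-! ## Kinematic glue -/

/-- The shear by `c·φ` undoes the shear by `(−c)·φ` (same axis, same driving coordinate). [folklore] -/
theorem shearMap_amp_shearMap_amp_neg {d : Type*} [DecidableEq d] {i j : d} (hij : i ≠ j) (Q : ShearProfile) (c : ℝ)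
    (x : UnitAddTorus d) : shearMap i j (amp Q c) (shearMap i j (amp Q (-c)) x) = x := by
  have hj : shearMap i j (amp Q (-c)) x j = x j := shearMap_apply_of_ne (amp Q (-c)) x hij.symm
  rw [shearMap_apply, hj, shearMap_apply, onCircle_amp, onCircle_amp, sub_sub, ← Pi.single_add]
  simp

/-- A profile vanishing on `ℝ` vanishes on the circle. [folklore] -/
theorem onCircle_eq_zero_of_forall {Z : ShearProfile} (hZ : ∀ y, Z y = 0) (b : UnitAddCircle) : Z.onCircle b = 0 := by
  induction b using QuotientAddGroup.induction_on with
  | H y => rw [ShearProfile.onCircle_coe, hZ]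

/-- `X·X̃ = X` lifts to the circle. [folklore] -/
theorem onCircle_mul_onCircle_eq_of_forall {X Xs : ShearProfile} (h : ∀ y, X y * Xs y = X y) (b : UnitAddCircle) :
    X.onCircle b * Xs.onCircle b = X.onCircle b := by
  induction b using QuotientAddGroup.induction_on with
  | H y => rw [ShearProfile.onCircle_coe, ShearProfile.onCircle_coe, h]

section Cascade

variable (P : CascadeParams)

/-- **The tracked-family step across the H half-slot of phase `j`** (one strip family, abstract per-fibre data).  Data:
the slot-lemma cut-off `X̃ = Xs` with derivative profile `Xsd`, `|X̃| ≤ 1`, `|X̃′| ≤ C₁`, `|X̃″| ≤ C₂`, flatness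
`|U_j′ − σ| ≤ ε₁` wherever `X̃ ≠ 0` or `X̃′ ≠ 0`, `γε₁ ≤ 1`; the un-gauging cut-off `X` with `X·X̃ = X` and a zero profile
`Z`; a classical cascade scalar `w` on `[0,1)`; the old symbol `μ` (`|μ| ≤ 1`) and the new symbol `m` (bounded); and the
per-fibre un-gauging estimate `hfib` for `(X, Z)` with constants `A, C` (the hypothesis of
`…SlotFibreSumMax.sqrt_tsum_symbol_sq_twoStrip_le_of_fibre_max` with `ν = μ`, `Φ = shearMap 0 1 (amp U_j γ)`).  Then
`‖m(D)(X(x₁)·w(t₁))‖ ≤ ‖μ(D)(X̃(x₁)·w(t₀))‖ + (E_slot + A + √(2C))·‖w(t₀)‖`.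
[cite: BedrossianCotiZelati2017, §2] [cite: Grafakos2014, Prop. 3.1.2 (5) and Prop. 3.2.7 (3)] -/
theorem sqrt_tsum_symbol_sq_family_step_H (hγ : 0 ≤ P.γ) (hδ₀ : 0 < P.δ₀) (hd : 0 < P.d) (j : ℕ)
    (Q Xs Xsd : ShearProfile) (hQ : ∀ y, Q y = deriv (P.U j) y) (hXsd : ∀ y, Xsd y = deriv Xs y)
    {κ σ ε₁ C₁ C₂ : ℝ} (hκ : 0 ≤ κ) (hε₁ : 0 ≤ ε₁) (hγε : P.γ * ε₁ ≤ 1) (hXs1 : ∀ y, |Xs y| ≤ 1)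
    (hC₁ : ∀ y, |Xsd y| ≤ C₁) (hC₂ : ∀ y, |deriv Xsd y| ≤ C₂) (hflat : ∀ y, Xs y ≠ 0 ∨ Xsd y ≠ 0 → |Q y - σ| ≤ ε₁)
    (X Z : ShearProfile) (hXXs : ∀ y, X y * Xs y = X y) (hZ : ∀ y, Z y = 0)
    {w : ℝ → UnitAddTorus (Fin 2) → ℝ} (hw : FluidPDE.Torus.IsClassicalScalarTransportOn (Ico 0 1) κ P.field w)
    {μ m : (Fin 2 → ℤ) → ℝ} (hμ1 : ∀ k, |μ k| ≤ 1) {M : ℝ} (hmM : ∀ k, |m k| ≤ M) {A C : ℝ} (hA0 : 0 ≤ A) (hC0 : 0 ≤ C)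
    (hfib : ∀ n : ℤ, ∀ G : UnitAddTorus (Fin 2) → ℂ, IsSmooth G → (∀ k, mFourierCoeff G k ≠ 0 → k 0 = n) →
      ∑' k, m k ^ 2 * ‖mFourierCoeff (fun x => ((X.onCircle (x 1) : ℂ) + Z.onCircle (x 1)) *
          G (shearMap 0 1 (amp ⟨P.U j, P.U_periodic j, P.contDiff_U (P.δ_pos hδ₀ hd j)⟩ P.γ) x)) k‖ ^ 2 ≤
        (Real.sqrt (∑' k, μ k ^ 2 * ‖mFourierCoeff G k‖ ^ 2) + A * Real.sqrt (∫ x, ‖G x‖ ^ 2)) ^ 2 +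
          2 * C * ∫ x, ‖G x‖ ^ 2) :
    Real.sqrt (∑' k, m k ^ 2 * ‖mFourierCoeff (fun x => ((X.onCircle (x 1) * w (tStart j + tHalf j) x : ℝ) : ℂ)) k‖ ^ 2) ≤
      Real.sqrt (∑' k, μ k ^ 2 * ‖mFourierCoeff (fun x => ((Xs.onCircle (x 1) * w (tStart j) x : ℝ) : ℂ)) k‖ ^ 2) +
        (2 * κ * tHalf j * C₂ + 4 * C₁ * Real.sqrt (κ * tHalf j / 2) +
            Real.sqrt (P.γ * ε₁ * (5 + 6 * C₁ ^ 2 * κ * tHalf j)) + A + Real.sqrt (2 * C)) *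
          Real.sqrt (FluidPDE.Torus.scalarL2Sq (w (tStart j))) := by
  set U : ShearProfile := ⟨P.U j, P.U_periodic j, P.contDiff_U (P.δ_pos hδ₀ hd j)⟩ with hU
  set t₀ : ℝ := tStart j with ht₀
  set t₁ : ℝ := tStart j + tHalf j with ht₁
  have h01 : (0 : Fin 2) ≠ 1 := by decide
  -- (1) the slot lemma with weights `μ²`
  have hw0 : ∀ k, 0 ≤ μ k ^ 2 := fun k => sq_nonneg _
  have hw1 : ∀ k, μ k ^ 2 ≤ 1 := fun k => by
    have h := hμ1 k
    rw [← sq_abs]; nlinarith [abs_nonneg (μ k)]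
  have hslot := sqrt_tsum_symbolEnergy_le_H_of_Ico P hγ hδ₀ hd j Q Xs Xsd hQ hXsd (σ := σ) hκ hε₁ hγε hXs1 hC₁ hC₂ hflat
    hw hw0 hw1
  -- the localised pull-back `θ`
  set θ : UnitAddTorus (Fin 2) → ℂ := fun x =>
    ((Xs.onCircle (x 1) * w t₁ (shearMap 0 1 (amp U (-P.γ)) x) : ℝ) : ℂ) with hθ_def
  have ht₁mem : t₁ ∈ Ico (0 : ℝ) 1 := ⟨by rw [ht₁]; linarith [tStart_nonneg j, tHalf_pos j], tStart_add_tHalf_lt_one j⟩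
  have hwt₁ : IsSmooth (w t₁) := hw.smooth_scalar.isSmooth_slice ht₁mem
  have hθfun : θ = fun x => ((Xs.onCircle (x 1) : ℝ) : ℂ) * (((w t₁ ∘ shearMap 0 1 (amp U (-P.γ))) x : ℝ) : ℂ) := by
    funext x; simp only [hθ_def, Function.comp_apply, Complex.ofReal_mul]
  have hθ : IsSmooth θ := by
    rw [hθfun]
    exact (isSmooth_onCircle_comp' Xs 1).ofReal_comp.mul (hwt₁.comp_shearMap 0 1 (amp U (-P.γ))).ofReal_comp
  -- (2) the un-gauging step for the family `X` (second cut-off zero)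
  have hmax := sqrt_tsum_symbol_sq_twoStrip_le_of_fibre_max hθ h01 (amp U P.γ) X Z hmM hμ1 hA0 hC0 hfib
  -- (3) kinematics: `X(x₁)·(θ∘Φ_γ) = X(x₁)·w(t₁)`
  have hfun : (fun x => ((X.onCircle (x 1) : ℂ) + Z.onCircle (x 1)) * θ (shearMap 0 1 (amp U P.γ) x)) =
      fun x => ((X.onCircle (x 1) * w t₁ x : ℝ) : ℂ) := by
    funext x
    have h1 : shearMap 0 1 (amp U P.γ) x 1 = x 1 := shearMap_apply_of_ne (amp U P.γ) x h01.symm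
    have h2 : shearMap 0 1 (amp U (-P.γ)) (shearMap 0 1 (amp U P.γ) x) = x := by
      have := shearMap_amp_shearMap_amp_neg h01 U (-P.γ) x
      rwa [neg_neg] at this
    simp only [hθ_def, h1, h2, onCircle_eq_zero_of_forall hZ, Complex.ofReal_zero, add_zero]
    rw [← Complex.ofReal_mul, ← mul_assoc, onCircle_mul_onCircle_eq_of_forall hXXs]
  rw [hfun] at hmax
  -- `‖θ‖ ≤ ‖w(t₀)‖`
  have hθL2 : Real.sqrt (∫ x, ‖θ x‖ ^ 2) ≤ Real.sqrt (FluidPDE.Torus.scalarL2Sq (w t₀)) := by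
    refine Real.sqrt_le_sqrt ?_
    have hwc : Continuous (w t₁ ∘ shearMap 0 1 (amp U (-P.γ))) := (hwt₁.comp_shearMap 0 1 (amp U (-P.γ))).continuous
    have hle : ∫ x, ‖θ x‖ ^ 2 ≤ ∫ x, (w t₁ (shearMap 0 1 (amp U (-P.γ)) x)) ^ 2 := by
      refine integral_mono (hθ.continuous.norm.pow 2).integrable_unitAddTorus (hwc.pow 2).integrable_unitAddTorus fun x => ?_
      simp only [hθ_def, Complex.norm_real, Real.norm_eq_abs, pow_two]
      rw [abs_mul]
      have hX : |Xs.onCircle (x 1)| ≤ 1 := by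
        obtain ⟨y, hy⟩ := QuotientAddGroup.mk_surjective (x 1)
        rw [← hy, ShearProfile.onCircle_coe]; exact hXs1 y
      have ha0 : 0 ≤ |Xs.onCircle (x 1)| := abs_nonneg _
      have h0 : 0 ≤ |w t₁ (shearMap 0 1 (amp U (-P.γ)) x)| := abs_nonneg _
      have hb : |w t₁ (shearMap 0 1 (amp U (-P.γ)) x)| * |w t₁ (shearMap 0 1 (amp U (-P.γ)) x)| =
          w t₁ (shearMap 0 1 (amp U (-P.γ)) x) * w t₁ (shearMap 0 1 (amp U (-P.γ)) x) := abs_mul_abs_self _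
      have h1 : |Xs.onCircle (x 1)| * |w t₁ (shearMap 0 1 (amp U (-P.γ)) x)| ≤
          |w t₁ (shearMap 0 1 (amp U (-P.γ)) x)| := by
        calc |Xs.onCircle (x 1)| * |w t₁ (shearMap 0 1 (amp U (-P.γ)) x)|
            ≤ 1 * |w t₁ (shearMap 0 1 (amp U (-P.γ)) x)| := mul_le_mul_of_nonneg_right hX h0
          _ = _ := one_mul _
      calc |Xs.onCircle (x 1)| * |w t₁ (shearMap 0 1 (amp U (-P.γ)) x)| *
            (|Xs.onCircle (x 1)| * |w t₁ (shearMap 0 1 (amp U (-P.γ)) x)|)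
          ≤ |w t₁ (shearMap 0 1 (amp U (-P.γ)) x)| * |w t₁ (shearMap 0 1 (amp U (-P.γ)) x)| :=
            mul_le_mul h1 h1 (mul_nonneg ha0 h0) h0
        _ = _ := hb
    have hcv : ∫ x, (w t₁ (shearMap 0 1 (amp U (-P.γ)) x)) ^ 2 = FluidPDE.Torus.scalarL2Sq (w t₁) :=
      integral_comp_shearMap h01 (amp U (-P.γ)) (fun x => w t₁ x ^ 2)
    have hdec : FluidPDE.Torus.scalarL2Sq (w t₁) ≤ FluidPDE.Torus.scalarL2Sq (w t₀) := by
      have ht : t₀ ≤ t₁ := by rw [ht₀, ht₁]; linarith [tHalf_pos j]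
      exact hw.antitoneOn_scalarL2Sq hκ (Icc_H_subset_Ico j) (left_mem_Icc.2 ht) (right_mem_Icc.2 ht) ht
    exact hle.trans (hcv.le.trans hdec)
  -- assemble
  have hAC0 : 0 ≤ A + Real.sqrt (2 * C) := add_nonneg hA0 (Real.sqrt_nonneg _)
  have hE0 : 0 ≤ 2 * κ * tHalf j * C₂ + 4 * C₁ * Real.sqrt (κ * tHalf j / 2) +
      Real.sqrt (P.γ * ε₁ * (5 + 6 * C₁ ^ 2 * κ * tHalf j)) := by
    have hC₁0 : 0 ≤ C₁ := (abs_nonneg _).trans (hC₁ 0)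
    have hC₂0 : 0 ≤ C₂ := (abs_nonneg _).trans (hC₂ 0)
    have := tHalf_pos j
    positivity
  calc Real.sqrt (∑' k, m k ^ 2 * ‖mFourierCoeff (fun x => ((X.onCircle (x 1) * w t₁ x : ℝ) : ℂ)) k‖ ^ 2)
      ≤ Real.sqrt (∑' k, μ k ^ 2 * ‖mFourierCoeff θ k‖ ^ 2) + (A + Real.sqrt (2 * C)) * Real.sqrt (∫ x, ‖θ x‖ ^ 2) := hmax
    _ ≤ (Real.sqrt (∑' k, μ k ^ 2 * ‖mFourierCoeff (fun x => ((Xs.onCircle (x 1) * w t₀ x : ℝ) : ℂ)) k‖ ^ 2) +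
          (2 * κ * tHalf j * C₂ + 4 * C₁ * Real.sqrt (κ * tHalf j / 2) +
            Real.sqrt (P.γ * ε₁ * (5 + 6 * C₁ ^ 2 * κ * tHalf j))) * Real.sqrt (FluidPDE.Torus.scalarL2Sq (w t₀))) +
        (A + Real.sqrt (2 * C)) * Real.sqrt (FluidPDE.Torus.scalarL2Sq (w t₀)) :=
          add_le_add hslot (mul_le_mul_of_nonneg_left hθL2 hAC0)
    _ = _ := by ring


/-- **The tracked-family step across the V half-slot of phase `j`** (indices swapped: the cut-offs read `x₀`, the fibres are
`k₁ = n`, `Φ = shearMap 1 0 (amp U_j γ)`, `t₀ = tStart j + tHalf j`, `t₁ = tStart (j+1)`; otherwise as in the H version).  Data: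
the slot-lemma cut-off `X̃ = Xs` with derivative profile `Xsd`, `|X̃| ≤ 1`, `|X̃′| ≤ C₁`, `|X̃″| ≤ C₂`, flatness
`|U_j′ − σ| ≤ ε₁` wherever `X̃ ≠ 0` or `X̃′ ≠ 0`, `γε₁ ≤ 1`; the un-gauging cut-off `X` with `X·X̃ = X` and a zero profile
`Z`; a classical cascade scalar `w` on `[0,1)`; the old symbol `μ` (`|μ| ≤ 1`) and the new symbol `m` (bounded); and the
per-fibre un-gauging estimate `hfib` for `(X, Z)` with constants `A, C` (the hypothesis of
`…SlotFibreSumMax.sqrt_tsum_symbol_sq_twoStrip_le_of_fibre_max` with `ν = μ`, `Φ = shearMap 1 0 (amp U_j γ)`).  Then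
`‖m(D)(X(x₀)·w(t₁))‖ ≤ ‖μ(D)(X̃(x₀)·w(t₀))‖ + (E_slot + A + √(2C))·‖w(t₀)‖`.
[cite: BedrossianCotiZelati2017, §2] [cite: Grafakos2014, Prop. 3.1.2 (5) and Prop. 3.2.7 (3)] -/
theorem sqrt_tsum_symbol_sq_family_step_V (hγ : 0 ≤ P.γ) (hδ₀ : 0 < P.δ₀) (hd : 0 < P.d) (j : ℕ)
    (Q Xs Xsd : ShearProfile) (hQ : ∀ y, Q y = deriv (P.U j) y) (hXsd : ∀ y, Xsd y = deriv Xs y)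
    {κ σ ε₁ C₁ C₂ : ℝ} (hκ : 0 ≤ κ) (hε₁ : 0 ≤ ε₁) (hγε : P.γ * ε₁ ≤ 1) (hXs1 : ∀ y, |Xs y| ≤ 1)
    (hC₁ : ∀ y, |Xsd y| ≤ C₁) (hC₂ : ∀ y, |deriv Xsd y| ≤ C₂) (hflat : ∀ y, Xs y ≠ 0 ∨ Xsd y ≠ 0 → |Q y - σ| ≤ ε₁)
    (X Z : ShearProfile) (hXXs : ∀ y, X y * Xs y = X y) (hZ : ∀ y, Z y = 0)
    {w : ℝ → UnitAddTorus (Fin 2) → ℝ} (hw : FluidPDE.Torus.IsClassicalScalarTransportOn (Ico 0 1) κ P.field w)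
    {μ m : (Fin 2 → ℤ) → ℝ} (hμ1 : ∀ k, |μ k| ≤ 1) {M : ℝ} (hmM : ∀ k, |m k| ≤ M) {A C : ℝ} (hA0 : 0 ≤ A) (hC0 : 0 ≤ C)
    (hfib : ∀ n : ℤ, ∀ G : UnitAddTorus (Fin 2) → ℂ, IsSmooth G → (∀ k, mFourierCoeff G k ≠ 0 → k 1 = n) →
      ∑' k, m k ^ 2 * ‖mFourierCoeff (fun x => ((X.onCircle (x 0) : ℂ) + Z.onCircle (x 0)) *
          G (shearMap 1 0 (amp ⟨P.U j, P.U_periodic j, P.contDiff_U (P.δ_pos hδ₀ hd j)⟩ P.γ) x)) k‖ ^ 2 ≤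
        (Real.sqrt (∑' k, μ k ^ 2 * ‖mFourierCoeff G k‖ ^ 2) + A * Real.sqrt (∫ x, ‖G x‖ ^ 2)) ^ 2 +
          2 * C * ∫ x, ‖G x‖ ^ 2) :
    Real.sqrt (∑' k, m k ^ 2 * ‖mFourierCoeff (fun x => ((X.onCircle (x 0) * w (tStart (j + 1)) x : ℝ) : ℂ)) k‖ ^ 2) ≤
      Real.sqrt (∑' k, μ k ^ 2 * ‖mFourierCoeff (fun x => ((Xs.onCircle (x 0) * w (tStart j + tHalf j) x : ℝ) : ℂ)) k‖ ^ 2) +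
        (2 * κ * tHalf j * C₂ + 4 * C₁ * Real.sqrt (κ * tHalf j / 2) +
            Real.sqrt (P.γ * ε₁ * (5 + 6 * C₁ ^ 2 * κ * tHalf j)) + A + Real.sqrt (2 * C)) *
          Real.sqrt (FluidPDE.Torus.scalarL2Sq (w (tStart j + tHalf j))) := by
  set U : ShearProfile := ⟨P.U j, P.U_periodic j, P.contDiff_U (P.δ_pos hδ₀ hd j)⟩ with hU
  set t₀ : ℝ := tStart j + tHalf j with ht₀
  set t₁ : ℝ := tStart (j + 1) with ht₁
  have h01 : (1 : Fin 2) ≠ 0 := by decide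
  -- (1) the slot lemma with weights `μ²`
  have hw0 : ∀ k, 0 ≤ μ k ^ 2 := fun k => sq_nonneg _
  have hw1 : ∀ k, μ k ^ 2 ≤ 1 := fun k => by
    have h := hμ1 k
    rw [← sq_abs]; nlinarith [abs_nonneg (μ k)]
  have hslot := sqrt_tsum_symbolEnergy_le_V_of_Ico P hγ hδ₀ hd j Q Xs Xsd hQ hXsd (σ := σ) hκ hε₁ hγε hXs1 hC₁ hC₂ hflat
    hw hw0 hw1
  -- the localised pull-back `θ`
  set θ : UnitAddTorus (Fin 2) → ℂ := fun x =>
    ((Xs.onCircle (x 0) * w t₁ (shearMap 1 0 (amp U (-P.γ)) x) : ℝ) : ℂ) with hθ_def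
  have ht₁mem : t₁ ∈ Ico (0 : ℝ) 1 := ⟨by rw [ht₁]; exact tStart_nonneg (j + 1), tStart_lt_one (j + 1)⟩
  have hwt₁ : IsSmooth (w t₁) := hw.smooth_scalar.isSmooth_slice ht₁mem
  have hθfun : θ = fun x => ((Xs.onCircle (x 0) : ℝ) : ℂ) * (((w t₁ ∘ shearMap 1 0 (amp U (-P.γ))) x : ℝ) : ℂ) := by
    funext x; simp only [hθ_def, Function.comp_apply, Complex.ofReal_mul]
  have hθ : IsSmooth θ := by
    rw [hθfun]
    exact (isSmooth_onCircle_comp' Xs 0).ofReal_comp.mul (hwt₁.comp_shearMap 1 0 (amp U (-P.γ))).ofReal_comp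
  -- (2) the un-gauging step for the family `X` (second cut-off zero)
  have hmax := sqrt_tsum_symbol_sq_twoStrip_le_of_fibre_max hθ h01 (amp U P.γ) X Z hmM hμ1 hA0 hC0 hfib
  -- (3) kinematics: `X(x₁)·(θ∘Φ_γ) = X(x₁)·w(t₁)`
  have hfun : (fun x => ((X.onCircle (x 0) : ℂ) + Z.onCircle (x 0)) * θ (shearMap 1 0 (amp U P.γ) x)) =
      fun x => ((X.onCircle (x 0) * w t₁ x : ℝ) : ℂ) := by
    funext x
    have h1 : shearMap 1 0 (amp U P.γ) x 0 = x 0 := shearMap_apply_of_ne (amp U P.γ) x h01.symm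
    have h2 : shearMap 1 0 (amp U (-P.γ)) (shearMap 1 0 (amp U P.γ) x) = x := by
      have := shearMap_amp_shearMap_amp_neg h01 U (-P.γ) x
      rwa [neg_neg] at this
    simp only [hθ_def, h1, h2, onCircle_eq_zero_of_forall hZ, Complex.ofReal_zero, add_zero]
    rw [← Complex.ofReal_mul, ← mul_assoc, onCircle_mul_onCircle_eq_of_forall hXXs]
  rw [hfun] at hmax
  -- `‖θ‖ ≤ ‖w(t₀)‖`
  have hθL2 : Real.sqrt (∫ x, ‖θ x‖ ^ 2) ≤ Real.sqrt (FluidPDE.Torus.scalarL2Sq (w t₀)) := by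
    refine Real.sqrt_le_sqrt ?_
    have hwc : Continuous (w t₁ ∘ shearMap 1 0 (amp U (-P.γ))) := (hwt₁.comp_shearMap 1 0 (amp U (-P.γ))).continuous
    have hle : ∫ x, ‖θ x‖ ^ 2 ≤ ∫ x, (w t₁ (shearMap 1 0 (amp U (-P.γ)) x)) ^ 2 := by
      refine integral_mono (hθ.continuous.norm.pow 2).integrable_unitAddTorus (hwc.pow 2).integrable_unitAddTorus fun x => ?_
      simp only [hθ_def, Complex.norm_real, Real.norm_eq_abs, pow_two]
      rw [abs_mul]
      have hX : |Xs.onCircle (x 0)| ≤ 1 := by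
        obtain ⟨y, hy⟩ := QuotientAddGroup.mk_surjective (x 0)
        rw [← hy, ShearProfile.onCircle_coe]; exact hXs1 y
      have ha0 : 0 ≤ |Xs.onCircle (x 0)| := abs_nonneg _
      have h0 : 0 ≤ |w t₁ (shearMap 1 0 (amp U (-P.γ)) x)| := abs_nonneg _
      have hb : |w t₁ (shearMap 1 0 (amp U (-P.γ)) x)| * |w t₁ (shearMap 1 0 (amp U (-P.γ)) x)| =
          w t₁ (shearMap 1 0 (amp U (-P.γ)) x) * w t₁ (shearMap 1 0 (amp U (-P.γ)) x) := abs_mul_abs_self _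
      have h1 : |Xs.onCircle (x 0)| * |w t₁ (shearMap 1 0 (amp U (-P.γ)) x)| ≤
          |w t₁ (shearMap 1 0 (amp U (-P.γ)) x)| := by
        calc |Xs.onCircle (x 0)| * |w t₁ (shearMap 1 0 (amp U (-P.γ)) x)|
            ≤ 1 * |w t₁ (shearMap 1 0 (amp U (-P.γ)) x)| := mul_le_mul_of_nonneg_right hX h0
          _ = _ := one_mul _
      calc |Xs.onCircle (x 0)| * |w t₁ (shearMap 1 0 (amp U (-P.γ)) x)| *
            (|Xs.onCircle (x 0)| * |w t₁ (shearMap 1 0 (amp U (-P.γ)) x)|)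
          ≤ |w t₁ (shearMap 1 0 (amp U (-P.γ)) x)| * |w t₁ (shearMap 1 0 (amp U (-P.γ)) x)| :=
            mul_le_mul h1 h1 (mul_nonneg ha0 h0) h0
        _ = _ := hb
    have hcv : ∫ x, (w t₁ (shearMap 1 0 (amp U (-P.γ)) x)) ^ 2 = FluidPDE.Torus.scalarL2Sq (w t₁) :=
      integral_comp_shearMap h01 (amp U (-P.γ)) (fun x => w t₁ x ^ 2)
    have hdec : FluidPDE.Torus.scalarL2Sq (w t₁) ≤ FluidPDE.Torus.scalarL2Sq (w t₀) := by
      have ht : t₀ ≤ t₁ := by rw [ht₀, ht₁, tStart_succ]; linarith [tHalf_pos j]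
      exact hw.antitoneOn_scalarL2Sq hκ (Icc_V_subset_Ico j) (left_mem_Icc.2 ht) (right_mem_Icc.2 ht) ht
    exact hle.trans (hcv.le.trans hdec)
  -- assemble
  have hAC0 : 0 ≤ A + Real.sqrt (2 * C) := add_nonneg hA0 (Real.sqrt_nonneg _)
  have hE0 : 0 ≤ 2 * κ * tHalf j * C₂ + 4 * C₁ * Real.sqrt (κ * tHalf j / 2) +
      Real.sqrt (P.γ * ε₁ * (5 + 6 * C₁ ^ 2 * κ * tHalf j)) := by
    have hC₁0 : 0 ≤ C₁ := (abs_nonneg _).trans (hC₁ 0)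
    have hC₂0 : 0 ≤ C₂ := (abs_nonneg _).trans (hC₂ 0)
    have := tHalf_pos j
    positivity
  calc Real.sqrt (∑' k, m k ^ 2 * ‖mFourierCoeff (fun x => ((X.onCircle (x 0) * w t₁ x : ℝ) : ℂ)) k‖ ^ 2)
      ≤ Real.sqrt (∑' k, μ k ^ 2 * ‖mFourierCoeff θ k‖ ^ 2) + (A + Real.sqrt (2 * C)) * Real.sqrt (∫ x, ‖θ x‖ ^ 2) := hmax
    _ ≤ (Real.sqrt (∑' k, μ k ^ 2 * ‖mFourierCoeff (fun x => ((Xs.onCircle (x 0) * w t₀ x : ℝ) : ℂ)) k‖ ^ 2) +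
          (2 * κ * tHalf j * C₂ + 4 * C₁ * Real.sqrt (κ * tHalf j / 2) +
            Real.sqrt (P.γ * ε₁ * (5 + 6 * C₁ ^ 2 * κ * tHalf j))) * Real.sqrt (FluidPDE.Torus.scalarL2Sq (w t₀))) +
        (A + Real.sqrt (2 * C)) * Real.sqrt (FluidPDE.Torus.scalarL2Sq (w t₀)) :=
          add_le_add hslot (mul_le_mul_of_nonneg_left hθL2 hAC0)
    _ = _ := by ring

end Cascade

end Summit.AnomalousDissipation.AnomalousDissipation.Theorems.SawtoothPulseCascade.K1Slot
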